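import Summits.NavierStokesRegularity.NavierStokesRegularity.Theorems.FilamentSkeletonRssKelvinGateRateLockingCube
import Summits.NavierStokesRegularity.NavierStokesRegularity.Theorems.FilamentSkeletonRssKelvinGateTools
import Summits.NavierStokesRegularity.NavierStokesRegularity.Theorems.FilamentSkeletonRssKelvinGateBilinear

/-!
# Route `FilamentSkeletonRss` · crux `TransverseReductionRJ` (stmt-NavierStokesRegularity-21221) — line `kelvin_gate`,
# stub S2′ `EventualKelvinGate`: RATE LOCKING, EXACT FORM — on a constant-rate box the cokernel component of the
# multiplier map is the cokernel pairing of the QUADRATIC remainder, `z · B_p = ℓ(DV_p[V_p])`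

Helper file (theorems only, `--supports stmt-NavierStokesRegularity-21221 --as helper`), in the vocabulary of
`FilamentSkeletonRssKelvinGateDefs` and of the rate-locking files of the line (g6: `…RateLocking`, `…RateLockingCube`).
HONEST FRAMING: bookkeeping for a HYPOTHETICAL filament-type RSS blow-up route (refutation side); nothing here bears on
Navier–Stokes regularity, and nothing here proves or refutes the stub.

g6's rate-locking identity `DB(p⋆)·z = ℓ(𝓡₀U⋆)·∇_pα(p⋆)` is the linearisation at the zero `p⋆` of an EXACT identity that needs
no differentiability in `p` at all.  Fix a rate `α`, an exact unforced profile `(U⋆, P⋆)`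
(`E_α(U⋆) + ∇P⋆ = 0`, e.g. the line's output at a zero of the multiplier map) and a linear functional `ℓ` annihilating the
range of the linearisation `𝓛_(α,U⋆) + ∇` on the divergence-free X class (an exact cokernel functional).  Then for ANY field
`U = U⋆ + V` solving the FORCED equation with the SAME rate, `E_α(U) + ∇P = Σ_j B_j D_j` (`V` X-bounded, divergence free,
`P − P⋆` bounded `C¹`):

* `pairing_quadratic_identity` — **`Σ_j B_j · ℓ(D_j) = ℓ(y ↦ DV(y)[V(y)])`**: the component of the multiplier vector
  along `z = (ℓ(D_j))_j` is the cokernel pairing of the quadratic remainder of `E_α` (`lerayOp_add_eq`);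
* `abs_pairing_le_sq` — with a gate at `U⋆` of constant `C` (clause-(1) data, e.g. from `GateSpec.perturb_core`) and
  `|ℓ(D_j)| ≤ η`: **`|Σ_j B_j ℓ(D_j)| ≤ N · η · C · 2 S²`** for `XBound V S` (the X·X→Y tameness `XBound.yBound_fderiv_apply`
  and the `ε = 0` cokernel bound `abs_le_of_divFreeCokernel_pairing`).

Reading (informal, for the planner): on a CONSTANT-RATE box the closed family `U_p = U⁰_p + W_p` is, at each `p`, a forced
solution with the same rate, so with `V_p := U_p − U⋆`, `z_p := (ℓ(D_pj))_j`: `z_p · B_p = ℓ(DV_p[V_p]) = O(X(V_p)²)`.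
Near the zero, `X(V_p) = O(|p − p⋆|)` for a Lipschitz-in-`p` family, so the `z`-component of `B` vanishes to SECOND order at
`p⋆` (first order = g6's identity with `∇α = 0`) and its leading term `ℓ(DV′[V′])|p−p⋆|²` along a line through `p⋆` is EVEN:
`z · B` does not change sign across `p⋆` along any direction `V′` with `ℓ(DV′[V′]) ≠ 0` — the zero is a touching zero in
the `z`-direction (local index `0` whenever the quadratic form is non-degenerate on `ker DB(p⋆)`), which is what makes a
face-sign-law (Miranda) zero non-generic on constant-rate boxes.  The box must scan the rate (g6) — or the crux takes the
R-β free-rate retype.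
-/

set_option linter.dupNamespace false

noncomputable section

namespace Summit.NavierStokesRegularity.NavierStokesRegularity.Theorems.KelvinGate

open Set Function Filter
open Literature.Analysis.FluidPDE
open scoped InnerProductSpace Laplacian ContDiff Topology BigOperators

/-! ## The exact identity -/

/-- **Exact rate-locking identity.**  Let `(U⋆, P⋆)` be an exact unforced profile of rate `α` (`E_α(U⋆) + ∇P⋆ = 0`),
`U⋆ ∈ C²`, and let `U⋆ + V`, `P` solve the forced equation `E_α(U⋆ + V) + ∇P = Σ_j B_j D_j` with the SAME rate, where
`V ∈ C²` is X-bounded and divergence free and `P − P⋆` is bounded `C¹` (`P, P⋆ ∈ C¹`).  If the linear functional `ℓ`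
annihilates `𝓛_(α,U⋆) W + ∇Q` for every divergence-free X-bounded `W` and bounded `C¹` `Q`, then
`Σ_j B_j ℓ(D_j) = ℓ(y ↦ DV(y)[V(y)])`. -/
theorem pairing_quadratic_identity {N : ℕ} (α : ℝ) {Us V : EuclideanSpace ℝ (Fin 3) → EuclideanSpace ℝ (Fin 3)}
    {Ps P : EuclideanSpace ℝ (Fin 3) → ℝ} {Dm : Fin N → EuclideanSpace ℝ (Fin 3) → EuclideanSpace ℝ (Fin 3)} {B : Fin N → ℝ}
    {S M : ℝ} (hUs : ContDiff ℝ 2 Us) (hPs : ContDiff ℝ 1 Ps) (hP : ContDiff ℝ 1 P)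
    (hstar : ∀ y, lerayOp α Us y + gradient Ps y = 0)
    (hforced : ∀ y, lerayOp α (fun z => Us z + V z) y + gradient P y = ∑ j, B j • Dm j y)
    (hV : XBound V S) (hVdiv : VectorCalculus.IsDivFree V) (hPM : ∀ y, |P y - Ps y| ≤ M)
    (ℓ : (EuclideanSpace ℝ (Fin 3) → EuclideanSpace ℝ (Fin 3)) →ₗ[ℝ] ℝ)
    (hrange : ∀ (W : EuclideanSpace ℝ (Fin 3) → EuclideanSpace ℝ (Fin 3)) (Q : EuclideanSpace ℝ (Fin 3) → ℝ) (S' : ℝ),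
      XBound W S' → VectorCalculus.IsDivFree W → ContDiff ℝ 1 Q → (∀ y, |Q y| ≤ S') →
      ℓ (fun y => lerayLin α Us W y + gradient Q y) = 0) :
    ∑ j, B j * ℓ (Dm j) = ℓ (fun y => fderiv ℝ V y (V y)) := by
  -- the forced equation minus the exact one: `𝓛 V + ∇(P − P⋆) = Σ B_j D_j − DV[V]` pointwise
  have hpt : ∀ y, lerayLin α Us V y + gradient (fun z => P z - Ps z) y =
      (∑ j, B j • Dm j y) - fderiv ℝ V y (V y) := by
    intro y
    have hadd := lerayOp_add_eq α Us V y hUs.contDiffAt (hV.1.contDiffAt)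
    have hgrad : gradient (fun z => P z - Ps z) y = gradient P y - gradient Ps y := by
      have h1 : DifferentiableAt ℝ P y := hP.differentiable one_ne_zero y
      have h2 : DifferentiableAt ℝ Ps y := hPs.differentiable one_ne_zero y
      rw [gradient, gradient, gradient, fderiv_fun_sub h1 h2, map_sub]
    have h0 := hstar y
    have h1 := hforced y
    rw [hadd] at h1
    rw [hgrad]
    -- linear combination of the two pointwise equations
    have : lerayLin α Us V y = (∑ j, B j • Dm j y) - fderiv ℝ V y (V y) - gradient P y - lerayOp α Us y := by
      rw [← h1]; abel
    rw [this]
    have h0' : lerayOp α Us y = -gradient Ps y := eq_neg_of_add_eq_zero_left h0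
    rw [h0']
    abel
  -- the X-radius of `V` with room for the pressure bound
  have hVX : XBound V (max S M) := hV.mono (le_max_left _ _)
  have hQ : ContDiff ℝ 1 (fun z => P z - Ps z) := hP.sub hPs
  have hQM : ∀ y, |(fun z => P z - Ps z) y| ≤ max S M := fun y => (hPM y).trans (le_max_right _ _)
  have key := hrange V (fun z => P z - Ps z) (max S M) hVX hVdiv hQ hQM
  have hfun : (fun y => lerayLin α Us V y + gradient (fun z => P z - Ps z) y) =
      (∑ j, B j • Dm j : EuclideanSpace ℝ (Fin 3) → EuclideanSpace ℝ (Fin 3)) - (fun y => fderiv ℝ V y (V y)) := by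
    funext y
    simp only [hpt y, Pi.sub_apply, Finset.sum_apply, Pi.smul_apply]
  rw [hfun, map_sub, map_sum] at key
  simp only [map_smul, smul_eq_mul] at key
  linarith

/-! ## The quantitative form: the cokernel component of `B` is quadratically small -/

/-- **`|z · B| ≤ N η C · 2S²`.**  In the situation of `pairing_quadratic_identity`, suppose in addition that the
linearisation at `U⋆` has a gate of constant `C` (clause-(1) data `(K, Qo, Bo)` modulo the same modes, divergence-free
output — e.g. the output of `GateSpec.perturb_core`) and that the mode pairings satisfy `|ℓ(D_j)| ≤ η`.  Then
`|Σ_j B_j ℓ(D_j)| ≤ N · η · (C · (2 S S))` for `XBound V S`: the component of the multiplier vector along the cokernel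
pairing vector is QUADRATIC in the X-distance of the solution from the exact profile. -/
theorem abs_pairing_le_sq {N : ℕ} (α : ℝ) {C η : ℝ} {Us V : EuclideanSpace ℝ (Fin 3) → EuclideanSpace ℝ (Fin 3)}
    {Ps P : EuclideanSpace ℝ (Fin 3) → ℝ} {Dm : Fin N → EuclideanSpace ℝ (Fin 3) → EuclideanSpace ℝ (Fin 3)} {B : Fin N → ℝ}
    {S M : ℝ}
    {K : (EuclideanSpace ℝ (Fin 3) → EuclideanSpace ℝ (Fin 3)) → EuclideanSpace ℝ (Fin 3) → EuclideanSpace ℝ (Fin 3)}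
    {Qo : (EuclideanSpace ℝ (Fin 3) → EuclideanSpace ℝ (Fin 3)) → EuclideanSpace ℝ (Fin 3) → ℝ}
    {Bo : (EuclideanSpace ℝ (Fin 3) → EuclideanSpace ℝ (Fin 3)) → Fin N → ℝ}
    (hK : ∀ (F : EuclideanSpace ℝ (Fin 3) → EuclideanSpace ℝ (Fin 3)) (R : ℝ), YBound F R →
      XBound (K F) (C * R) ∧ ContDiff ℝ 1 (Qo F) ∧ (∀ y, |Qo F y| ≤ C * R) ∧ (∀ j, |Bo F j| ≤ C * R) ∧
      VectorCalculus.IsDivFree (K F) ∧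
      ∀ y, lerayLin α Us (K F) y + gradient (Qo F) y = F y + ∑ j, Bo F j • Dm j y)
    (hUs : ContDiff ℝ 2 Us) (hPs : ContDiff ℝ 1 Ps) (hP : ContDiff ℝ 1 P)
    (hstar : ∀ y, lerayOp α Us y + gradient Ps y = 0)
    (hforced : ∀ y, lerayOp α (fun z => Us z + V z) y + gradient P y = ∑ j, B j • Dm j y)
    (hV : XBound V S) (hVdiv : VectorCalculus.IsDivFree V) (hPM : ∀ y, |P y - Ps y| ≤ M)
    (ℓ : (EuclideanSpace ℝ (Fin 3) → EuclideanSpace ℝ (Fin 3)) →ₗ[ℝ] ℝ)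
    (hrange : ∀ (W : EuclideanSpace ℝ (Fin 3) → EuclideanSpace ℝ (Fin 3)) (Q : EuclideanSpace ℝ (Fin 3) → ℝ) (S' : ℝ),
      XBound W S' → VectorCalculus.IsDivFree W → ContDiff ℝ 1 Q → (∀ y, |Q y| ≤ S') →
      ℓ (fun y => lerayLin α Us W y + gradient Q y) = 0)
    (hη : ∀ j, |ℓ (Dm j)| ≤ η) :
    |∑ j, B j * ℓ (Dm j)| ≤ N * η * (C * (2 * S * S)) := by
  rw [pairing_quadratic_identity α hUs hPs hP hstar hforced hV hVdiv hPM ℓ hrange]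
  exact abs_le_of_divFreeCokernel_pairing hK ℓ hrange hη _ _ (hV.yBound_fderiv_apply hV)

/-- **Corollary (the zero set of the cokernel component).**  In the situation of `pairing_quadratic_identity`, if the
quadratic pairing vanishes, `ℓ(DV[V]) = 0` (in particular at the exact profile itself, `V = 0`), then the multiplier
vector is orthogonal to the pairing vector: `Σ_j B_j ℓ(D_j) = 0`. -/
theorem pairing_eq_zero_of_quadratic_eq_zero {N : ℕ} (α : ℝ) {Us V : EuclideanSpace ℝ (Fin 3) → EuclideanSpace ℝ (Fin 3)}
    {Ps P : EuclideanSpace ℝ (Fin 3) → ℝ} {Dm : Fin N → EuclideanSpace ℝ (Fin 3) → EuclideanSpace ℝ (Fin 3)} {B : Fin N → ℝ}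
    {S M : ℝ} (hUs : ContDiff ℝ 2 Us) (hPs : ContDiff ℝ 1 Ps) (hP : ContDiff ℝ 1 P)
    (hstar : ∀ y, lerayOp α Us y + gradient Ps y = 0)
    (hforced : ∀ y, lerayOp α (fun z => Us z + V z) y + gradient P y = ∑ j, B j • Dm j y)
    (hV : XBound V S) (hVdiv : VectorCalculus.IsDivFree V) (hPM : ∀ y, |P y - Ps y| ≤ M)
    (ℓ : (EuclideanSpace ℝ (Fin 3) → EuclideanSpace ℝ (Fin 3)) →ₗ[ℝ] ℝ)
    (hrange : ∀ (W : EuclideanSpace ℝ (Fin 3) → EuclideanSpace ℝ (Fin 3)) (Q : EuclideanSpace ℝ (Fin 3) → ℝ) (S' : ℝ),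
      XBound W S' → VectorCalculus.IsDivFree W → ContDiff ℝ 1 Q → (∀ y, |Q y| ≤ S') →
      ℓ (fun y => lerayLin α Us W y + gradient Q y) = 0)
    (hquad : ℓ (fun y => fderiv ℝ V y (V y)) = 0) :
    ∑ j, B j * ℓ (Dm j) = 0 := by
  rw [pairing_quadratic_identity α hUs hPs hP hstar hforced hV hVdiv hPM ℓ hrange, hquad]

end Summit.NavierStokesRegularity.NavierStokesRegularity.Theorems.KelvinGate

end
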